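import Summits.NavierStokesRegularity.TurbBounds.LayerForm
import Summits.NavierStokesRegularity.TurbBounds.LegendreCoeffs
import Summits.NavierStokesRegularity.TurbBounds.TailSeqP2R0
import Summits.NavierStokesRegularity.TurbBounds.TailBridgeP2R0
import HarnessLib

/-!
# Row P2-R0 tail lemma, part 3 — positivity of the layer form on POLYNOMIAL test fields
(cell `pub-turb` / `turb-bounds`; v2 staging of R-T / R-P2d.)

HONEST FRAMING: rigorous bounds for the stated PDE and boundary conditions; no claim about physical turbulence beyond the bound.
`layerForm_poly_nonneg`: for the member `(s, κ, η′) = (3/2, 4, 1)` of row P2-R0, every `K > 0`, every rational `ε > 0` with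
`MelR ε (1/K) K ⪰ 0` and the two tail slacks `≥ 0` (= the conjuncts of `Certs.P2R0.Evaluator.certificate`), and all real
POLYNOMIALS `V, Θ` with `V(-1) = V'(-1) = Θ(-1) = 0`, the rescaled layer form SPEC-P2 (1.1) is `≥ 0`. Chain: the form is the
integral of a polynomial expression ⇒ Parseval in the Legendre basis (`LegendreCoeffs`) turns it into the `ℓ²` form of the
coefficient sequences of `V'', V', V, Θ', Θ`, which obey the integration ladders ⇒ `TailSeqP2R0.seq_split` bounds it below by
the tracked finite part + two slack terms ⇒ the finite part is `ψᵀ·MelR·ψ ≥ 0` (`TailBridgeP2R0.quadForm_MelR`) and the slacks are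
the certificate's scalar lines times squared tail norms.
-/

set_option linter.style.longLine false
set_option linter.style.setOption false

noncomputable section

namespace Summit.NavierStokesRegularity.TurbBounds.TailP2R0

open Polynomial intervalIntegral MeasureTheory Finset Matrix
open Summit.NavierStokesRegularity.TurbBounds.LayerForm
open Summit.NavierStokesRegularity.TurbBounds.LadderTail (w IsLadder phi lam w_pos)
open Summit.NavierStokesRegularity.TurbBounds.LegendreCoeffs
open Summit.NavierStokesRegularity.TurbBounds.Certs.P2R0.Evaluator (MelR s T ghat0 lamW lamT)

/-- integral over `[-1, 1]` of a six-term combination of continuous functions -/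
private theorem integral_comb6 {f1 f2 f3 f4 f5 f6 : ℝ → ℝ} (h1 : Continuous f1) (h2 : Continuous f2) (h3 : Continuous f3)
    (h4 : Continuous f4) (h5 : Continuous f5) (h6 : Continuous f6) (c1 c2 c3 c4 c5 c6 : ℝ) :
    ∫ x in (-1 : ℝ)..1, (c1 * f1 x + c2 * f2 x + c3 * f3 x + c4 * f4 x + c5 * f5 x + c6 * f6 x)
      = c1 * (∫ x in (-1 : ℝ)..1, f1 x) + c2 * (∫ x in (-1 : ℝ)..1, f2 x) + c3 * (∫ x in (-1 : ℝ)..1, f3 x)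
        + c4 * (∫ x in (-1 : ℝ)..1, f4 x) + c5 * (∫ x in (-1 : ℝ)..1, f5 x) + c6 * (∫ x in (-1 : ℝ)..1, f6 x) := by
  have I : ∀ {g : ℝ → ℝ}, Continuous g → IntervalIntegrable g volume (-1 : ℝ) 1 := fun hg => hg.intervalIntegrable _ _
  rw [integral_add (I (by fun_prop)) (I (by fun_prop)), integral_add (I (by fun_prop)) (I (by fun_prop)),
    integral_add (I (by fun_prop)) (I (by fun_prop)), integral_add (I (by fun_prop)) (I (by fun_prop)),
    integral_add (I (by fun_prop)) (I (by fun_prop))]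
  simp only [intervalIntegral.integral_const_mul]

/-- The stacked vector `ψ = (c_0..c_6; d_0..d_5)` of the first Legendre coefficients of `V''` and `Θ'`. -/
def stack (c d : ℕ → ℝ) : Fin 13 → ℝ := ![c 0, c 1, c 2, c 3, c 4, c 5, c 6, d 0, d 1, d 2, d 3, d 4, d 5]

/-- Dictionary: on sequences linked by the integration ladders, the explicit finite part at the stacked vector is the tracked
finite part of `seq_split` (the ladder forms `aL, bL, eL` evaluate to `a_n, b_n, e_n`). -/
theorem finitePart_stack {c a b d e : ℕ → ℝ} (hA : IsLadder c a) (hB : IsLadder a b) (hE : IsLadder d e)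
    (ha0 : a 0 = c 0 - c 1 / 3) (hb0 : b 0 = a 0 - a 1 / 3) (he0 : e 0 = d 0 - d 1 / 3) (ε : ℚ) (u v : ℝ) :
    finitePart ε u v (stack c d)
      = ((s : ℝ) - 1) * (16 * u * ∑ n ∈ range 7, w n * c n ^ 2 + 8 * ∑ n ∈ range 6, w n * a n ^ 2
            + v * ∑ n ∈ range 5, w n * b n ^ 2)
        + (s : ℝ) * (4 * ∑ n ∈ range 6, w n * d n ^ 2 + v * ∑ n ∈ range 5, w n * e n ^ 2)
        + 2 * (ghat0 : ℝ) * ∑ n ∈ range 5, w n * b n * e n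
        - (T : ℝ) * (ε : ℝ) * (phi 4 * a 4 ^ 2 + phi 5 * a 5 ^ 2 + lam 4 * (phi 5 * c 5 ^ 2 + phi 6 * c 6 ^ 2))
        - (T : ℝ) / (ε : ℝ) * (phi 4 * d 4 ^ 2 + phi 5 * d 5 ^ 2) := by
  have ha1 : a 1 = c 0 - c 2 / 5 := by have h := hA 0; norm_num at h; linarith
  have ha2 : a 2 = c 1 / 3 - c 3 / 7 := by have h := hA 1; norm_num at h; linarith
  have ha3 : a 3 = c 2 / 5 - c 4 / 9 := by have h := hA 2; norm_num at h; linarith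
  have ha4 : a 4 = c 3 / 7 - c 5 / 11 := by have h := hA 3; norm_num at h; linarith
  have ha5 : a 5 = c 4 / 9 - c 6 / 13 := by have h := hA 4; norm_num at h; linarith
  have hb1 : b 1 = a 0 - a 2 / 5 := by have h := hB 0; norm_num at h; linarith
  have hb2 : b 2 = a 1 / 3 - a 3 / 7 := by have h := hB 1; norm_num at h; linarith
  have hb3 : b 3 = a 2 / 5 - a 4 / 9 := by have h := hB 2; norm_num at h; linarith
  have hb4 : b 4 = a 3 / 7 - a 5 / 11 := by have h := hB 3; norm_num at h; linarith
  have he1 : e 1 = d 0 - d 2 / 5 := by have h := hE 0; norm_num at h; linarith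
  have he2 : e 2 = d 1 / 3 - d 3 / 7 := by have h := hE 1; norm_num at h; linarith
  have he3 : e 3 = d 2 / 5 - d 4 / 9 := by have h := hE 2; norm_num at h; linarith
  have he4 : e 4 = d 3 / 7 - d 5 / 11 := by have h := hE 3; norm_num at h; linarith
  simp only [sum_range_succ, sum_range_zero, zero_add]
  rw [hb0, hb1, hb2, hb3, hb4, he0, he1, he2, he3, he4, ha0, ha1, ha2, ha3, ha4, ha5]
  unfold finitePart
  simp only [sum_range_succ, sum_range_zero, zero_add, xc, xd, aL, bL, eL, stack]
  simp only [Matrix.cons_val_zero, Matrix.cons_val_one, Matrix.cons_val]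

/-- The layer form of the member `(3/2, 4, 1)` on polynomial test fields as a combination of six polynomial integrals. -/
theorem layerForm_poly_eq (K : ℝ) (hK : K ≠ 0) (Vp Θp : ℝ[X]) :
    layerForm (3 / 2) 4 (fun _ => 1) K (fun x => Vp.eval x) (fun x => Θp.eval x)
      = (8 / K) * (∫ x in (-1 : ℝ)..1, (derivative (derivative Vp)).eval x ^ 2)
        + 4 * (∫ x in (-1 : ℝ)..1, (derivative Vp).eval x ^ 2)
        + (K / 2) * (∫ x in (-1 : ℝ)..1, Vp.eval x ^ 2) + 6 * (∫ x in (-1 : ℝ)..1, (derivative Θp).eval x ^ 2)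
        + (3 * K / 2) * (∫ x in (-1 : ℝ)..1, Θp.eval x ^ 2) + (-6) * (∫ x in (-1 : ℝ)..1, Vp.eval x * Θp.eval x) := by
  have hdV : deriv (fun x => Vp.eval x) = fun x => (derivative Vp).eval x := by
    funext x; exact Polynomial.deriv Vp
  have hdV1 : deriv (fun x => (derivative Vp).eval x) = fun x => (derivative (derivative Vp)).eval x := by
    funext x; exact Polynomial.deriv (derivative Vp)
  have hdΘ : deriv (fun x => Θp.eval x) = fun x => (derivative Θp).eval x := by
    funext x; exact Polynomial.deriv Θp
  unfold layerForm
  rw [← integral_comb6 (by fun_prop) (by fun_prop) (by fun_prop) (by fun_prop) (by fun_prop) (by fun_prop)]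
  refine intervalIntegral.integral_congr fun x _ => ?_
  simp only [layerIntegrand, gOf, hdV, hdV1, hdΘ]
  field_simp
  ring

/-- **Positivity of the P2-R0 layer form on polynomial test fields** (R-T / R-P2d for `(N, P) = (4, 0)`, proved). -/
theorem layerForm_poly_nonneg {K : ℝ} (hK : 0 < K) {ε : ℚ} (hε : 0 < ε)
    (hM : (MelR ε (1 / K) K).PosSemidef)
    (hW : 0 ≤ 16 * (1 / K) * ((s : ℝ) - 1) - (T : ℝ) * (ε : ℝ) * (lamW : ℝ))
    (hT : 0 ≤ 4 * s - T * lamT / ε)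
    (Vp Θp : ℝ[X]) (hV0 : Vp.eval (-1) = 0) (hV1 : (derivative Vp).eval (-1) = 0) (hΘ0 : Θp.eval (-1) = 0) :
    0 ≤ layerForm (3 / 2) 4 (fun _ => 1) K (fun x => Vp.eval x) (fun x => Θp.eval x) := by
  have hform := layerForm_poly_eq K hK.ne' Vp Θp
  -- names
  set V1 := derivative Vp with hV1def
  set V2 := derivative V1 with hV2def
  set Θ1 := derivative Θp with hΘ1def
  -- Parseval with window length L + 2, L := max degrees
  set L := max Vp.natDegree Θp.natDegree with hL
  have hdegV : Vp.natDegree ≤ L := le_max_left _ _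
  have hdegΘ : Θp.natDegree ≤ L := le_max_right _ _
  have hdegV1 : V1.natDegree ≤ L := by
    rw [hV1def]; exact (natDegree_derivative_le Vp).trans (by omega)
  have hdegV2 : V2.natDegree ≤ L := by
    rw [hV2def]; exact (natDegree_derivative_le V1).trans (by omega)
  have hdegΘ1 : Θ1.natDegree ≤ L := by
    rw [hΘ1def]; exact (natDegree_derivative_le Θp).trans (by omega)
  set c := legCoeff V2 with hc
  set a := legCoeff V1 with ha
  set b := legCoeff Vp with hb
  set d := legCoeff Θ1 with hd
  set e := legCoeff Θp with he
  have hPc : ∫ x in (-1 : ℝ)..1, V2.eval x ^ 2 = ∑ n ∈ range 7, w n * c n ^ 2 + ∑ k ∈ range (L + 2), w (7 + k) * c (7 + k) ^ 2 := by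
    rw [integral_sq_eq_sum_of_lt V2 (R := 7 + (L + 2)) (by omega), sum_range_add]
  have hPa : ∫ x in (-1 : ℝ)..1, V1.eval x ^ 2 = ∑ n ∈ range 6, w n * a n ^ 2 + ∑ k ∈ range (L + 2), w (6 + k) * a (6 + k) ^ 2 := by
    rw [integral_sq_eq_sum_of_lt V1 (R := 6 + (L + 2)) (by omega), sum_range_add]
  have hPb : ∫ x in (-1 : ℝ)..1, Vp.eval x ^ 2 = ∑ n ∈ range 5, w n * b n ^ 2 + ∑ k ∈ range (L + 2), w (5 + k) * b (5 + k) ^ 2 := by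
    rw [integral_sq_eq_sum_of_lt Vp (R := 5 + (L + 2)) (by omega), sum_range_add]
  have hPd : ∫ x in (-1 : ℝ)..1, Θ1.eval x ^ 2 = ∑ n ∈ range 6, w n * d n ^ 2 + ∑ k ∈ range (L + 2), w (6 + k) * d (6 + k) ^ 2 := by
    rw [integral_sq_eq_sum_of_lt Θ1 (R := 6 + (L + 2)) (by omega), sum_range_add]
  have hPe : ∫ x in (-1 : ℝ)..1, Θp.eval x ^ 2 = ∑ n ∈ range 5, w n * e n ^ 2 + ∑ k ∈ range (L + 2), w (5 + k) * e (5 + k) ^ 2 := by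
    rw [integral_sq_eq_sum_of_lt Θp (R := 5 + (L + 2)) (by omega), sum_range_add]
  have hPbe : ∫ x in (-1 : ℝ)..1, Vp.eval x * Θp.eval x
      = ∑ n ∈ range 5, w n * b n * e n + ∑ k ∈ range (L + 2), w (5 + k) * b (5 + k) * e (5 + k) := by
    rw [integral_mul_eq_sum_of_lt Vp Θp (R := 5 + (L + 2)) (by omega) (by omega), sum_range_add]
  -- ladders
  have hA : IsLadder c a := by rw [hc, ha, hV2def]; exact isLadder_legCoeff V1 hV1
  have hB : IsLadder a b := by rw [ha, hb, hV1def]; exact isLadder_legCoeff Vp hV0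
  have hE : IsLadder d e := by rw [hd, he, hΘ1def]; exact isLadder_legCoeff Θp hΘ0
  have ha0 : a 0 = c 0 - c 1 / 3 := by rw [ha, hc, hV2def]; exact legCoeff_zero_of_wall V1 hV1
  have hb0 : b 0 = a 0 - a 1 / 3 := by rw [hb, ha, hV1def]; exact legCoeff_zero_of_wall Vp hV0
  have he0 : e 0 = d 0 - d 1 / 3 := by rw [he, hd, hΘ1def]; exact legCoeff_zero_of_wall Θp hΘ0
  -- the coefficient sequences are now opaque
  clear_value c a b d e
  -- the ℓ² split inequality
  have hs1 : (1 : ℝ) ≤ ((s : ℚ) : ℝ) := by norm_num [s]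
  have hg : |((ghat0 : ℚ) : ℝ)| ≤ ((T : ℚ) : ℝ) := by norm_num [ghat0, T]
  have hεR : (0 : ℝ) < (ε : ℝ) := by exact_mod_cast hε
  have hsplit := seq_split (u := 1 / K) hA hB hE hs1 hK.le hεR hg L
  have hfin := finitePart_stack hA hB hE ha0 hb0 he0 ε (1 / K) K
  -- abbreviate the tails
  set Rc := ∑ k ∈ range (L + 2), w (7 + k) * c (7 + k) ^ 2 with hRc
  set Ra := ∑ k ∈ range (L + 2), w (6 + k) * a (6 + k) ^ 2 with hRa
  set Rb := ∑ k ∈ range (L + 2), w (5 + k) * b (5 + k) ^ 2 with hRb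
  set Rd := ∑ k ∈ range (L + 2), w (6 + k) * d (6 + k) ^ 2 with hRd
  set Re := ∑ k ∈ range (L + 2), w (5 + k) * e (5 + k) ^ 2 with hRe
  set Rbe := ∑ k ∈ range (L + 2), w (5 + k) * b (5 + k) * e (5 + k) with hRbe
  -- the layer form IS the Parseval form
  have hlayer : layerForm (3 / 2) 4 (fun _ => 1) K (fun x => Vp.eval x) (fun x => Θp.eval x)
      = ((s : ℝ) - 1) * (16 * (1 / K) * (∑ n ∈ range 7, w n * c n ^ 2 + Rc) + 8 * (∑ n ∈ range 6, w n * a n ^ 2 + Ra)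
            + K * (∑ n ∈ range 5, w n * b n ^ 2 + Rb))
        + (s : ℝ) * (4 * (∑ n ∈ range 6, w n * d n ^ 2 + Rd) + K * (∑ n ∈ range 5, w n * e n ^ 2 + Re))
        + 2 * (ghat0 : ℝ) * (∑ n ∈ range 5, w n * b n * e n + Rbe) := by
    rw [hform, hPc, hPa, hPb, hPd, hPe, hPbe]
    simp only [s, ghat0]
    push_cast
    field_simp
    ring
  -- the three nonnegative pieces
  have hfin0 : 0 ≤ finitePart ε (1 / K) K (stack c d) := finitePart_nonneg hM _
  have hRc0 : 0 ≤ Rc := sum_nonneg fun k _ => mul_nonneg (w_pos _).le (sq_nonneg _)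
  have hRd0 : 0 ≤ Rd := sum_nonneg fun k _ => mul_nonneg (w_pos _).le (sq_nonneg _)
  have hlamW : (lamW : ℝ) = lam 4 * lam 5 := by norm_num [lamW, lam]
  have hlamT : (lamT : ℝ) = lam 4 := by norm_num [lamT, lam]
  have hW' : 0 ≤ (16 * (1 / K) * ((s : ℝ) - 1) - (T : ℝ) * (ε : ℝ) * (lam 4 * lam 5)) * Rc := by
    rw [← hlamW]; exact mul_nonneg hW hRc0
  have hT' : 0 ≤ (4 * (s : ℝ) - (T : ℝ) * lam 4 / (ε : ℝ)) * Rd := by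
    refine mul_nonneg ?_ hRd0
    have h : (0 : ℝ) ≤ 4 * (s : ℝ) - (T : ℝ) * (lamT : ℝ) / (ε : ℝ) := by exact_mod_cast hT
    rwa [hlamT] at h
  rw [hlayer]
  linarith [hsplit, hfin, hfin0, hW', hT']

end Summit.NavierStokesRegularity.TurbBounds.TailP2R0

end
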